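import Literature.Combinatorics.SetFamily.KatonaIntersectingShadow
import Mathlib.Combinatorics.Hall.Basic
import HarnessLib

/-!
# `NoHeavyLowerTail` (crux stmt-CriticalPhenomena-4575), hull-port line hp-7: the IC/CoI-KLEITMAN CONJECTURE
# in the ANTICHAIN case — a theorem, via Katona's intersecting shadow theorem

Support file (prover `prim-hp-7`, generation 52; `--supports stmt-CriticalPhenomena-4575`).  No definitions, no `sorry`,
standard axioms.  Memos: `prim-hp-7/FROM-prim-hp-7-g50-IC-KLEITMAN.md` §0 (S2), §7(b); `FROM-prim-hp-7-g52-KATONA-ANTICHAIN.md`.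

The IC/CoI-Kleitman conjecture (memo g50, S2; = prim-ineq-gen-3's Conjecture O_k without 'opposite-free'): for a
CONVEX family `Z ⊆ 2^F` and a pairwise CO-INTERSECTING family `S` of sets `ζ` with `ζ, F∖ζ ∈ Z` in different Hasse
components of `Z`, the targets `↑S ∖ (Z ∪ cZ)` are at least `#S` many (Hall form: for every up-set `𝒰`,
`#(S ∩ 𝒰) ≤ #(targets in 𝒰 above S ∩ 𝒰)`).  Exhaustively verified for `|F| ≤ 5` and in `> 10¹⁰` random/structured
instances (memo g50); proved for two petals (`…TwoPetalCoInt`, p303438) and, by prim-ineq-gen-3, for all opposite-free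
type sets on `≤ 4` components and the acyclic ones.

THIS FILE: the ANTICHAIN corner (`Z` an antichain, e.g. the middle layer of `2^{2m}`; 'different components' is then
automatic and EVERY strict superset of a source is a target).  There the count `#S ≤ #(↑S ∖ (Z ∪ cZ))` alone is already a
consequence of the Marica–Schönheim inequality (the sets `ζ ∪ (univ ∖ ξ)`, `ζ, ξ ∈ S`, are targets and are the
complements of the differences `(univ∖ζ) ∖ (univ∖ξ)`); what is proved here is the SHARPER local form in which the
targets are taken ONE LEVEL UP only (`t = insert x ζ`), and that is exactly Katona's intersecting shadow theorem:
* `JBern.card_le_card_upShadow_of_union_ne_univ` — a pairwise co-intersecting family `S` (`ζ ∪ ξ ≠ univ`) has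
  `#S ≤ #∂⁺S` (complements of Katona's theorem in its non-uniform form
  `Literature.Combinatorics.SetFamily.card_le_card_shadow_of_intersecting`, p309051).
* `JBern.card_filter_le_card_filter_target_of_isAntichain` — IC-KLEITMAN FOR ANTICHAIN `Z`, Hall form: `Z` an
  antichain, `S` pairwise co-intersecting with `ζ, univ∖ζ ∈ Z` for `ζ ∈ S`; then for every up-set `𝒰`,
  `#(S ∩ 𝒰) ≤ #{t ∈ 𝒰 : t ∉ Z, univ∖t ∉ Z, t ⊇ ζ for some ζ ∈ S ∩ 𝒰}` (the up-shadow of `S ∩ 𝒰` consists of such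
  targets: `insert x ζ ∉ Z` and `univ ∖ insert x ζ ∉ Z` by the antichain property).
* `JBern.card_le_card_filter_target_of_isAntichain` — the global count `#S ≤ #(↑S ∖ (Z ∪ cZ))`.
* `JBern.exists_injOn_target_of_isAntichain` — SDR form: a map `φ`, injective on `S`, with `ζ ⊆ φ ζ`, `φ ζ ∉ Z`,
  `univ ∖ φ ζ ∉ Z` (Hall's marriage theorem, `Finset.all_card_le_biUnion_card_iff_exists_injective`).
[this work]
-/

namespace Summit.CriticalPhenomena.PercolationContinuityZ3.Theorems.JBern

open Finset
open scoped FinsetFamily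

variable {α : Type*} [Fintype α] [DecidableEq α]

/-- **Co-intersecting families grow under the up-shadow** (dual of Katona's intersecting shadow theorem in its
non-uniform form): if `ζ ∪ ξ ≠ univ` for all `ζ, ξ ∈ S`, then `#S ≤ #∂⁺S`. [this work] -/
theorem card_le_card_upShadow_of_union_ne_univ (S : Finset (Finset α))
    (hC : ∀ ζ ∈ S, ∀ ξ ∈ S, ζ ∪ ξ ≠ univ) : #S ≤ #(∂⁺ S) := by
  have hI : ((Sᶜˢ : Finset (Finset α)) : Set (Finset α)).Intersecting := by
    intro a ha b hb hab
    rw [mem_coe, mem_compls] at ha hb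
    apply hC _ ha _ hb
    rw [← compl_inter, disjoint_iff_inter_eq_empty.1 hab, compl_empty]
  calc #S = #Sᶜˢ := (card_compls _).symm
    _ ≤ #(∂ Sᶜˢ) := Literature.Combinatorics.SetFamily.card_le_card_shadow_of_intersecting hI
    _ = #((∂⁺ S)ᶜˢ) := by rw [shadow_compls]
    _ = #(∂⁺ S) := card_compls _

/-- **IC-Kleitman conjecture, antichain case, Hall form** (this work; Katona's theorem at its core).  Let `Z` be an
antichain of subsets of a finite set, `S` a family with `ζ ∈ Z` and `univ ∖ ζ ∈ Z` for every `ζ ∈ S`, pairwise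
co-intersecting (`ζ ∪ ξ ≠ univ`).  Then for every up-set `𝒰` the members of `S` in `𝒰` are at most as many as the
sets `t ∈ 𝒰` with `t ∉ Z`, `univ ∖ t ∉ Z` lying above some member of `S ∩ 𝒰`. [this work] -/
theorem card_filter_le_card_filter_target_of_isAntichain (Z : Finset (Finset α))
    (hZ : IsAntichain (· ⊆ ·) (Z : Set (Finset α))) (S : Finset (Finset α))
    (hS : ∀ ζ ∈ S, ζ ∈ Z ∧ univ \ ζ ∈ Z) (hC : ∀ ζ ∈ S, ∀ ξ ∈ S, ζ ∪ ξ ≠ univ)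
    (𝒰 : Finset (Finset α)) (h𝒰 : IsUpperSet (𝒰 : Set (Finset α))) :
    #(S.filter fun ζ => ζ ∈ 𝒰) ≤
      #(𝒰.filter fun t => t ∉ Z ∧ univ \ t ∉ Z ∧ ∃ ζ ∈ S, ζ ∈ 𝒰 ∧ ζ ⊆ t) := by
  set S' := S.filter fun ζ => ζ ∈ 𝒰 with hS'
  have hC' : ∀ ζ ∈ S', ∀ ξ ∈ S', ζ ∪ ξ ≠ univ :=
    fun ζ hζ ξ hξ => hC ζ (mem_filter.1 hζ).1 ξ (mem_filter.1 hξ).1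
  refine (card_le_card_upShadow_of_union_ne_univ S' hC').trans (card_le_card fun t ht => ?_)
  rw [mem_upShadow_iff] at ht
  obtain ⟨ζ, hζ, x, hx, rfl⟩ := ht
  obtain ⟨hζS, hζ𝒰⟩ := mem_filter.1 hζ
  obtain ⟨hζZ, hcζZ⟩ := hS ζ hζS
  have hssub : ζ ⊂ insert x ζ := ssubset_insert hx
  have hsub' : univ \ insert x ζ ⊆ univ \ ζ := sdiff_subset_sdiff subset_rfl (subset_insert x ζ)
  have hne' : univ \ insert x ζ ≠ univ \ ζ := fun h => by
    have hx' : x ∈ univ \ ζ := mem_sdiff.2 ⟨mem_univ x, hx⟩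
    rw [← h] at hx'
    exact (mem_sdiff.1 hx').2 (mem_insert_self x ζ)
  refine mem_filter.2 ⟨h𝒰 hssub.subset hζ𝒰, fun h => hssub.ne (hZ.eq hζZ h hssub.subset),
    fun h => hne' (hZ.eq h hcζZ hsub'), ζ, hζS, hζ𝒰, hssub.subset⟩

/-- **IC-Kleitman conjecture, antichain case, global count** (this work): with `Z`, `S` as above,
`#S ≤ #{t : t ∉ Z, univ ∖ t ∉ Z, t ⊇ ζ for some ζ ∈ S}` = `#(↑S ∖ (Z ∪ cZ))`. [this work] -/
theorem card_le_card_filter_target_of_isAntichain (Z : Finset (Finset α))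
    (hZ : IsAntichain (· ⊆ ·) (Z : Set (Finset α))) (S : Finset (Finset α))
    (hS : ∀ ζ ∈ S, ζ ∈ Z ∧ univ \ ζ ∈ Z) (hC : ∀ ζ ∈ S, ∀ ξ ∈ S, ζ ∪ ξ ≠ univ) :
    #S ≤ #((univ : Finset (Finset α)).filter fun t => t ∉ Z ∧ univ \ t ∉ Z ∧ ∃ ζ ∈ S, ζ ⊆ t) := by
  have h := card_filter_le_card_filter_target_of_isAntichain Z hZ S hS hC univ
    (by rw [coe_univ]; exact isUpperSet_univ)
  rw [filter_true_of_mem fun ζ _ => mem_univ ζ] at h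
  refine h.trans (card_le_card fun t ht => ?_)
  obtain ⟨-, htZ, hctZ, ζ, hζS, -, hζt⟩ := mem_filter.1 ht
  exact mem_filter.2 ⟨mem_univ t, htZ, hctZ, ζ, hζS, hζt⟩

/-- **IC-Kleitman conjecture, antichain case, SDR form** (this work): with `Z`, `S` as above there is an INCREASING
INJECTION of `S` into the targets: `φ` injective on `S` with `ζ ⊆ φ ζ`, `φ ζ ∉ Z`, `univ ∖ φ ζ ∉ Z`.  (Hall's marriage
theorem applied to the Hall-form count with `𝒰` = the up-closure of a sub-family.) [this work] -/
theorem exists_injOn_target_of_isAntichain (Z : Finset (Finset α))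
    (hZ : IsAntichain (· ⊆ ·) (Z : Set (Finset α))) (S : Finset (Finset α))
    (hS : ∀ ζ ∈ S, ζ ∈ Z ∧ univ \ ζ ∈ Z) (hC : ∀ ζ ∈ S, ∀ ξ ∈ S, ζ ∪ ξ ≠ univ) :
    ∃ φ : Finset α → Finset α, Set.InjOn φ S ∧ ∀ ζ ∈ S, ζ ⊆ φ ζ ∧ φ ζ ∉ Z ∧ univ \ φ ζ ∉ Z := by
  classical
  -- targets above a source
  let T : Finset α → Finset (Finset α) := fun ζ => univ.filter fun t => ζ ⊆ t ∧ t ∉ Z ∧ univ \ t ∉ Z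
  -- Hall's condition for the family `T` restricted to `S`
  have hHall : ∀ A : Finset S, #A ≤ #(A.biUnion fun ζ => T ζ) := by
    intro A
    -- the up-closure of (the image of) `A`
    set A' : Finset (Finset α) := A.map (Function.Embedding.subtype _) with hA'
    set 𝒰 : Finset (Finset α) := univ.filter fun t => ∃ ζ ∈ A', ζ ⊆ t with h𝒰
    have h𝒰up : IsUpperSet (𝒰 : Set (Finset α)) := by
      intro a b hab ha
      rw [mem_coe, mem_filter] at ha ⊢
      obtain ⟨-, ζ, hζ, hζa⟩ := ha
      exact ⟨mem_univ b, ζ, hζ, hζa.trans hab⟩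
    have hA'S : A' ⊆ S := fun ζ hζ => by
      obtain ⟨z, -, rfl⟩ := mem_map.1 hζ
      exact z.2
    have hA'𝒰 : A' ⊆ S.filter fun ζ => ζ ∈ 𝒰 := fun ζ hζ =>
      mem_filter.2 ⟨hA'S hζ, mem_filter.2 ⟨mem_univ ζ, ζ, hζ, subset_rfl⟩⟩
    have h := card_filter_le_card_filter_target_of_isAntichain Z hZ S hS hC 𝒰 h𝒰up
    have hsub : (𝒰.filter fun t => t ∉ Z ∧ univ \ t ∉ Z ∧ ∃ ζ ∈ S, ζ ∈ 𝒰 ∧ ζ ⊆ t) ⊆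
        A.biUnion fun ζ => T ζ := by
      intro t ht
      obtain ⟨ht𝒰, htZ, hctZ, -⟩ := mem_filter.1 ht
      obtain ⟨-, ζ, hζA', hζt⟩ := mem_filter.1 ht𝒰
      obtain ⟨z, hzA, rfl⟩ := mem_map.1 hζA'
      exact mem_biUnion.2 ⟨z, hzA, mem_filter.2 ⟨mem_univ t, hζt, htZ, hctZ⟩⟩
    calc #A = #A' := (card_map _).symm
      _ ≤ #(S.filter fun ζ => ζ ∈ 𝒰) := card_le_card hA'𝒰
      _ ≤ _ := h
      _ ≤ #(A.biUnion fun ζ => T ζ) := card_le_card hsub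
  obtain ⟨f, hf, hfT⟩ := (all_card_le_biUnion_card_iff_exists_injective fun ζ : S => T ζ).1 hHall
  refine ⟨fun ζ => if h : ζ ∈ S then f ⟨ζ, h⟩ else ζ, ?_, ?_⟩
  · intro ζ hζ ξ hξ hφ
    have hζ' : ζ ∈ S := hζ
    have hξ' : ξ ∈ S := hξ
    simp only [dif_pos hζ', dif_pos hξ'] at hφ
    exact congrArg Subtype.val (hf hφ)
  · intro ζ hζ
    simp only [dif_pos hζ]
    have := mem_filter.1 (hfT ⟨ζ, hζ⟩)
    exact this.2

end Summit.CriticalPhenomena.PercolationContinuityZ3.Theorems.JBern
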